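import Literature.Topology.FourManifolds.SchoenfliesSphereTwo
import Literature.Topology.FourManifolds.HCobordismIndexZeroOneProofs
import Literature.Topology.FourManifolds.SPC4HandlesNormalFormProofs
import HarnessLib

/-!
# The smooth Schoenflies theorem on `S²`, unconditionally

Topic `Literature/Topology/FourManifolds`; one-line specialisations recording that the two
cancellation leaves of `SchoenfliesSphereTwo.lean` are now theorems of the tree:
`Cobordism.Milnor1965_cancel_index_zero_holds` (`HCobordismIndexZeroOneProofs.lean`: Milnor,
*Lectures on the h-cobordism theorem* (1965), Thm. 8.1, Index 0) and
`exists_isMorseAdapted_ncard_criticalSetOfIndex_zero_add_one_eq_holds`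
(`SPC4HandlesNormalFormProofs.lean`: the cancellation step on a manifold with boundary).  Hence
the `_of_facts` theorems of `SchoenfliesSphereTwo.lean` hold outright:

* `SphereHypersurfaceSides.IsSidePackage.nonempty_diffeomorph_closedBall_sides_holds` — both
  closed sides of a smooth circle in `S²` are smooth discs;
* `SphereEmbedding.exists_diffeomorph_image_eq_inner`,
  `SphereEmbedding.exists_diffeomorph_image_eq_sphereEquator_one` — **the smooth Schoenflies
  theorem on `S²`**: a diffeomorphism of `S²` carries any smoothly embedded circle onto a great
  circle (the standard equator);
* `SphereEmbedding.schoenflies_exists_ball_one_two` — the two-sided ball form, the literal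
  `n = 2` analogue of the named fact `SphereEmbedding.schoenflies_exists_ball` of
  `SchoenfliesSphereThree.lean`.

This is the two-dimensional input of Alexander's theorem (Schultens (2014), proof of
Thm. 3.2.5, PDF pp. 44–45: level circles bound discs in their planes, and separate the sphere
into two discs), needed by the exp-height line of the fact seat
`provefact-Literature.Topology.FourManifolds.SphereEmbedding.schoenflies_exists_ball` for doming
the flat faces produced by its sweep and fill moves (`SweepBelowLevel.lean`,
`FillBelowLevel.lean`).  Everything here is proved; no definitions, no named facts.

## References

* J. Schultens, *Introduction to 3-Manifolds*, GSM 151 (2014), Thm. 3.2.5 (PDF pp. 43–45).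
  [Schultens2014]
* J. Milnor, *Lectures on the h-cobordism theorem*, Princeton (1965), Thm. 8.1 (Index 0),
  Thm. 5.4. [MilnorHCobordism1965]
* M. W. Hirsch, *Differential Topology*, GTM 33 (1976), Ch. 8 §2, Thm. 2.1; Ch. 9 §3.
  [HirschDT1976]
-/

open scoped Manifold ContDiff Topology RealInnerProductSpace
open Set Function Metric

noncomputable section

namespace Literature.Topology.FourManifolds

/-- **Both closed sides of a smooth circle in `S²` are smooth discs** (unconditional form of
`SphereHypersurfaceSides.IsSidePackage.nonempty_diffeomorph_closedBall_sides`). [folklore] -/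
theorem SphereHypersurfaceSides.IsSidePackage.nonempty_diffeomorph_closedBall_sides_holds
    {Z : Set (sphere (0 : EuclideanSpace ℝ (Fin (1 + 1 + 1))) 1)}
    {g : sphere (0 : EuclideanSpace ℝ (Fin (1 + 1 + 1))) 1 → ℝ}
    (hg : SphereHypersurfaceSides.IsSidePackage (m := 1) Z g) (hZ : Z.Nonempty) :
    Nonempty (RegularSublevel hg.isRegularLevel ≃ₘ⟮𝓡∂ (1 + 1), 𝓡∂ (1 + 1)⟯
        (closedBall (0 : EuclideanSpace ℝ (Fin (1 + 1))) 1)) ∧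
      Nonempty (RegularSuperlevel hg.isRegularLevel ≃ₘ⟮𝓡∂ (1 + 1), 𝓡∂ (1 + 1)⟯
        (closedBall (0 : EuclideanSpace ℝ (Fin (1 + 1))) 1)) :=
  hg.nonempty_diffeomorph_closedBall_sides Cobordism.Milnor1965_cancel_index_zero_holds
    (exists_isMorseAdapted_ncard_criticalSetOfIndex_zero_add_one_eq_holds 1) hZ

/-- **The smooth Schoenflies theorem on `S²`, great-circle form**: every smoothly embedded
circle `S ⊆ S²` is carried onto the great circle `vᗮ ∩ S²` by a diffeomorphism of `S²`.
[cite: Schultens2014, proof of Thm. 3.2.5 (PDF p. 44)] -/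
theorem SphereEmbedding.exists_diffeomorph_image_eq_inner (S : SphereEmbedding 1 2)
    (v : sphere (0 : EuclideanSpace ℝ (Fin (2 + 1))) 1) :
    ∃ ψ : (sphere (0 : EuclideanSpace ℝ (Fin (2 + 1))) 1) ≃ₘ⟮𝓡 2, 𝓡 2⟯
        (sphere (0 : EuclideanSpace ℝ (Fin (2 + 1))) 1),
      ψ '' range S = {q : sphere (0 : EuclideanSpace ℝ (Fin (2 + 1))) 1 |
        ⟪(q : EuclideanSpace ℝ (Fin (2 + 1))), (v : EuclideanSpace ℝ (Fin (2 + 1)))⟫ = 0} :=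
  S.exists_diffeomorph_image_eq_inner_of_facts Cobordism.Milnor1965_cancel_index_zero_holds
    (exists_isMorseAdapted_ncard_criticalSetOfIndex_zero_add_one_eq_holds 1) v

/-- **The smooth Schoenflies theorem on `S²`, equator form**: some diffeomorphism of `S²`
carries `range S` onto the standard equator `sphereEquator 1`.
[cite: Schultens2014, proof of Thm. 3.2.5 (PDF p. 44)] -/
theorem SphereEmbedding.exists_diffeomorph_image_eq_sphereEquator_one (S : SphereEmbedding 1 2) :
    ∃ ψ : (sphere (0 : EuclideanSpace ℝ (Fin (2 + 1))) 1) ≃ₘ⟮𝓡 2, 𝓡 2⟯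
        (sphere (0 : EuclideanSpace ℝ (Fin (2 + 1))) 1), ψ '' range S = sphereEquator 1 :=
  S.exists_diffeomorph_image_eq_sphereEquator_one_of_facts
    Cobordism.Milnor1965_cancel_index_zero_holds
    (exists_isMorseAdapted_ncard_criticalSetOfIndex_zero_add_one_eq_holds 1)

/-- **The smooth Schoenflies theorem on `S²`, two-sided ball form**: for every smoothly
embedded circle `S ⊆ S²` and every point `p ∉ S` there is a smooth embedding `e : ℝ² → S²`
with `e(∂𝔻²) = S` whose closed disc misses `p` — the `n = 2` analogue of the named fact
`SphereEmbedding.schoenflies_exists_ball`. [cite: Schultens2014, proof of Thm. 3.2.5 (PDF pp. 44–45)] -/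
theorem SphereEmbedding.schoenflies_exists_ball_one_two (S : SphereEmbedding 1 2)
    {p : sphere (0 : EuclideanSpace ℝ (Fin (2 + 1))) 1} (hp : p ∉ range S) :
    ∃ e : EuclideanSpace ℝ (Fin 2) → sphere (0 : EuclideanSpace ℝ (Fin (2 + 1))) 1,
      Manifold.IsSmoothEmbedding (𝓡 2) (𝓡 2) ∞ e ∧
        e '' sphere (0 : EuclideanSpace ℝ (Fin 2)) 1 = range S ∧
        p ∉ e '' closedBall (0 : EuclideanSpace ℝ (Fin 2)) 1 :=
  S.schoenflies_exists_ball_one_two_of_facts Cobordism.Milnor1965_cancel_index_zero_holds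
    (exists_isMorseAdapted_ncard_criticalSetOfIndex_zero_add_one_eq_holds 1) hp

end Literature.Topology.FourManifolds

end
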